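import Summits.KontsevichZagierPeriods.KontsevichZagierPeriods.Theorems.UnfoldedStokesStokesGenerationStubClampedNewtonLeibniz
import Literature.NumberTheory.Transcendental.SemialgebraicAlgebraicPoints
import Literature.NumberTheory.Transcendental.SemialgebraicMapsProofs

/-!
# `StokesGeneration` (stmt-KontsevichZagierPeriods-3586) — line `fibrewise_stokes`, stub `stub_clampedLoopPiece`

Registered rung stub X11 (rung 10e, the angular sector of a semialgebraic `C¹` loop) of the line
`fibrewise_stokes` of the crux `StokesGeneration` (route UnfoldedStokes): **one clamped, rotated
piece of a semialgebraic loop.**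

Data: a `C¹` loop `(A, B)` on `[0,1]` (the four functions `A`, `B`, `A′`, `B′` continuous on `[0,1]`
and `ℚ`-semialgebraic on the interval coordinate, `A′`, `B′` the derivatives on `(0,1)`,
`A² + B² ≠ 0`) and a piece `[a, b] ⊆ [0,1]` of the partition of `stub_saPartition` with algebraic
ends, on which `A·A(a) + B·B(a) > 0`. With the clamp `c(u) = max a (min u b)` (continuous, onto
`[a,b]`, the identity on `[a,b]`, kinks at `a`, `b`) the piece is the loop clamped to `[a,b]` and
rotated by `conj (A(a) + i B(a))` into the right half-plane:
`U = A(c)·A(a) + B(c)·B(a) > 0`, `W = B(c)·A(a) − A(c)·B(a)`, with the fibre derivatives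
`U′ = 1_{(a,b)}·(A′ A(a) + B′ B(a))`, `W′ = 1_{(a,b)}·(B′ A(a) − A′ B(a))` off the two kinks (inside
`(a,b)` the clamp is the identity near the point, outside `[a,b]` it is locally constant). The
angular form is rotation invariant: `U W′ − U′ W = (A(a)² + B(a)²)(A B′ − A′ B)` and
`U² + W² = (A(a)² + B(a)²)(A² + B²)`, so `(U W′ − U′ W)/(U² + W²)` is `(A B′ − A′ B)/(A² + B²)` on
`(a,b)` and `0` off `[a,b]`. Semialgebraicity: the clamp is `ℚ`-semialgebraic with values in
`[0,1]` (`rungClamp_sa_clamp`), composition is Tarski–Seidenberg (Bochnak–Coste–Roy, Prop. 2.2.6),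
`A(a)`, `B(a)` are algebraic as values of `ℚ`-semialgebraic functions at an algebraic point, and
the indicator of the strip is `ℚ`-semialgebraic (`rungClamp_sa_indicator`).

References: M. Kontsevich, D. Zagier, *Periods* (2001), §1.1–1.2; J. Ayoub, *Une version relative
de la conjecture des périodes de Kontsevich–Zagier*, Ann. of Math. 181 (2015), Rem. 1.5;
J. Bochnak, M. Coste, M.-F. Roy, *Real Algebraic Geometry* (1998), Prop. 2.2.6.
-/

noncomputable section

-- `Summit.KontsevichZagierPeriods.KontsevichZagierPeriods.…` is the tree's mandated layout (single-conjunct summit).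
set_option linter.dupNamespace false

namespace Summit.KontsevichZagierPeriods.KontsevichZagierPeriods.Cruxes.StokesGeneration.FibrewiseStokes

open MeasureTheory Set
open Literature.NumberTheory.Transcendental
open Literature.NumberTheory.Transcendental.KZ
open Literature.ModelTheory.ExponentialFields (IsSemialgebraic)

/-- A `ℚ`-semialgebraic function of the interval coordinate composed with the clamp
`u ↦ max a (min u b)` onto `[a, b] ⊆ [0,1]` (`a`, `b` algebraic) stays `ℚ`-semialgebraic on the
interval: the composite of `z ↦ h (z 0)` with the semialgebraic self-map `z ↦ (c (z 0))` of the
interval (Tarski–Seidenberg). [cite: BochnakCosteRoy1998, Prop. 2.2.6] -/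
theorem clampLP_isSemialgebraicFunOn_comp {h : ℝ → ℝ} {a b : ℝ}
    (hh : IsSemialgebraicFunOn ℚ (Set.pi Set.univ (fun _ : Fin 1 => Set.Icc (0:ℝ) 1))
      (fun z => h (z 0)))
    (ha : IsAlgebraic ℚ a) (hb : IsAlgebraic ℚ b) (ha0 : 0 ≤ a) (hab : a ≤ b) (hb1 : b ≤ 1) :
    IsSemialgebraicFunOn ℚ (Set.pi Set.univ (fun _ : Fin 1 => Set.Icc (0:ℝ) 1))
      (fun z => h (max a (min (z 0) b))) := by
  have hIsa : IsSemialgebraic ℚ (Set.pi Set.univ (fun _ : Fin 1 => Set.Icc (0:ℝ) 1)) := by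
    rw [← cube_eq_pi]; exact isSemialgebraic_cube
  have hcsa : IsSemialgebraicFunOn ℚ (Set.pi Set.univ (fun _ : Fin 1 => Set.Icc (0:ℝ) 1))
      (fun z => max a (min (z 0) b)) := rungClamp_sa_clamp hIsa ha hb 0
  have hΨ : IsSemialgebraicMapOn ℚ (Set.pi Set.univ (fun _ : Fin 1 => Set.Icc (0:ℝ) 1))
      (fun z => fun _ : Fin 1 => max a (min (z 0) b)) :=
    IsSemialgebraicMapOn.of_forall hIsa fun _ => hcsa
  have hmaps : Set.MapsTo (fun z => fun _ : Fin 1 => max a (min (z 0) b))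
      (Set.pi Set.univ (fun _ : Fin 1 => Set.Icc (0:ℝ) 1))
      (Set.pi Set.univ (fun _ : Fin 1 => Set.Icc (0:ℝ) 1)) :=
    fun z _ => Set.mem_univ_pi.mpr fun _ =>
      ⟨ha0.trans (clampNL_mem_Icc hab (z 0)).1, (clampNL_mem_Icc hab (z 0)).2.trans hb1⟩
  exact IsSemialgebraicFunOn.comp_isSemialgebraicMapOn_holds hh hΨ hmaps

/-- **Registered stub `stub_clampedLoopPiece` (rung 10e, X11): one clamped, rotated piece of a
semialgebraic `C¹` loop.** For a `C¹` loop `(A, B)` on `[0,1]` (`ℚ`-semialgebraic, `A² + B² ≠ 0`)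
and a piece `[a, b] ⊆ [0,1]` with algebraic ends on which `A·A(a) + B·B(a) > 0`, the loop clamped
to `[a,b]` (`c(u) = max a (min u b)`) and rotated by `conj (A(a) + i B(a))`,
`U = A(c) A(a) + B(c) B(a)`, `W = B(c) A(a) − A(c) B(a)`, is `ℚ`-semialgebraic, continuous,
`U > 0` on `[0,1]`, with bounded `ℚ`-semialgebraic fibre derivatives
`U′ = 1_{(a,b)} (A′ A(a) + B′ B(a))`, `W′ = 1_{(a,b)} (B′ A(a) − A′ B(a))` off the kinks `a`, `b`,
and its angular form `(U W′ − U′ W)/(U² + W²)` is `(A B′ − A′ B)/(A² + B²)` on `(a,b)` and `0` off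
`[a,b]` (rotation invariance). [cite: Ayoub2015, Rem. 1.5] -/
theorem stub_clampedLoopPiece :
    ∀ (A B A' B' : ℝ → ℝ) (a b : ℝ),
      IsSemialgebraicFunOn ℚ (Set.pi Set.univ (fun _ : Fin 1 => Set.Icc (0:ℝ) 1)) (fun z => A (z 0)) → IsSemialgebraicFunOn ℚ (Set.pi Set.univ (fun _ : Fin 1 => Set.Icc (0:ℝ) 1)) (fun z => B (z 0)) →
      IsSemialgebraicFunOn ℚ (Set.pi Set.univ (fun _ : Fin 1 => Set.Icc (0:ℝ) 1)) (fun z => A' (z 0)) → IsSemialgebraicFunOn ℚ (Set.pi Set.univ (fun _ : Fin 1 => Set.Icc (0:ℝ) 1)) (fun z => B' (z 0)) →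
      ContinuousOn A (Set.Icc (0:ℝ) 1) → ContinuousOn B (Set.Icc (0:ℝ) 1) →
      ContinuousOn A' (Set.Icc (0:ℝ) 1) → ContinuousOn B' (Set.Icc (0:ℝ) 1) →
      (∀ u ∈ Set.Ioo (0:ℝ) 1, HasDerivAt A (A' u) u) → (∀ u ∈ Set.Ioo (0:ℝ) 1, HasDerivAt B (B' u) u) →
      (∀ u ∈ Set.Icc (0:ℝ) 1, A u ^ 2 + B u ^ 2 ≠ 0) →
      IsAlgebraic ℚ a → IsAlgebraic ℚ b → 0 ≤ a → a < b → b ≤ 1 →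
      (∀ u ∈ Set.Icc a b, 0 < A u * A a + B u * B a) →
      ∃ (U W U' W' : ℝ → ℝ),
        IsSemialgebraicFunOn ℚ (Set.pi Set.univ (fun _ : Fin 1 => Set.Icc (0:ℝ) 1)) (fun z => U (z 0)) ∧ IsSemialgebraicFunOn ℚ (Set.pi Set.univ (fun _ : Fin 1 => Set.Icc (0:ℝ) 1)) (fun z => W (z 0)) ∧
        IsSemialgebraicFunOn ℚ (Set.pi Set.univ (fun _ : Fin 1 => Set.Icc (0:ℝ) 1)) (fun z => U' (z 0)) ∧ IsSemialgebraicFunOn ℚ (Set.pi Set.univ (fun _ : Fin 1 => Set.Icc (0:ℝ) 1)) (fun z => W' (z 0)) ∧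
        ContinuousOn U (Set.Icc (0:ℝ) 1) ∧ ContinuousOn W (Set.Icc (0:ℝ) 1) ∧
        (∀ u ∈ Set.Icc (0:ℝ) 1, 0 < U u) ∧
        (∃ Bd : ℝ, ∀ u ∈ Set.Icc (0:ℝ) 1, |U' u| ≤ Bd ∧ |W' u| ≤ Bd) ∧
        (∀ u ∈ Set.Ioo (0:ℝ) 1, u ≠ a → u ≠ b → HasDerivAt U (U' u) u ∧ HasDerivAt W (W' u) u) ∧
        (∀ u ∈ Set.Icc (0:ℝ) 1, U u = A (max a (min u b)) * A a + B (max a (min u b)) * B a) ∧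
        (∀ u ∈ Set.Icc (0:ℝ) 1, W u = B (max a (min u b)) * A a - A (max a (min u b)) * B a) ∧
        ∀ u ∈ Set.Icc (0:ℝ) 1, u ≠ a → u ≠ b →
          (U u * W' u - U' u * W u) / (U u ^ 2 + W u ^ 2) =
            if a < u ∧ u < b then (A u * B' u - A' u * B u) / (A u ^ 2 + B u ^ 2) else 0 := by
  intro A B A' B' a b hAsa hBsa hA'sa hB'sa hAc hBc hA'c hB'c hAd hBd hE ha hb ha0 hab hb1 hpos
  -- the interval as a `Fin 1`-cube
  set I : Set (Fin 1 → ℝ) := Set.pi Set.univ (fun _ : Fin 1 => Set.Icc (0:ℝ) 1) with hI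
  have hIsa : IsSemialgebraic ℚ I := by rw [hI, ← cube_eq_pi]; exact isSemialgebraic_cube
  have hale : a ≤ b := hab.le
  have ha1 : a ≤ 1 := hale.trans hb1
  -- the clamp `c u = max a (min u b)` onto `[a, b] ⊆ [0, 1]`
  have hcmem : ∀ s : ℝ, max a (min s b) ∈ Set.Icc a b := fun s => clampNL_mem_Icc hale s
  have hc01 : ∀ s : ℝ, max a (min s b) ∈ Set.Icc (0:ℝ) 1 := fun s =>
    ⟨ha0.trans (hcmem s).1, (hcmem s).2.trans hb1⟩
  -- the algebraic constants `A a`, `B a` (values of semialgebraic functions at an algebraic point)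
  have haI : (fun _ : Fin 1 => a) ∈ I := Set.mem_univ_pi.mpr fun _ => ⟨ha0, ha1⟩
  have hAa : IsAlgebraic ℚ (A a) := hAsa.isAlgebraic_apply haI fun _ => ha
  have hBa : IsAlgebraic ℚ (B a) := hBsa.isAlgebraic_apply haI fun _ => ha
  have hAasa : IsSemialgebraicFunOn ℚ I (fun _ => A a) := isSemialgebraicFunOn_const_of_isAlgebraic hIsa hAa
  have hBasa : IsSemialgebraicFunOn ℚ I (fun _ => B a) := isSemialgebraicFunOn_const_of_isAlgebraic hIsa hBa
  have hE0 : A a ^ 2 + B a ^ 2 ≠ 0 := hE a ⟨ha0, ha1⟩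
  -- the clamped atoms are semialgebraic and continuous
  have hAcsa : IsSemialgebraicFunOn ℚ I (fun z => A (max a (min (z 0) b))) :=
    clampLP_isSemialgebraicFunOn_comp hAsa ha hb ha0 hale hb1
  have hBcsa : IsSemialgebraicFunOn ℚ I (fun z => B (max a (min (z 0) b))) :=
    clampLP_isSemialgebraicFunOn_comp hBsa ha hb ha0 hale hb1
  have hAcc : Continuous fun s => A (max a (min s b)) :=
    clampNL_continuous hale (hAc.mono (Set.Icc_subset_Icc ha0 hb1))
  have hBcc : Continuous fun s => B (max a (min s b)) :=
    clampNL_continuous hale (hBc.mono (Set.Icc_subset_Icc ha0 hb1))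
  -- the indicator `χ = 1_{(a,b)}` of the open strip
  set χ : ℝ → ℝ := fun u => if a < u ∧ u < b then (1:ℝ) else 0 with hχ
  have hχabs : ∀ u, |χ u| ≤ 1 := fun u => by
    simp only [hχ]
    split_ifs <;> simp
  have hχsa : IsSemialgebraicFunOn ℚ I (fun z => χ (z 0)) := rungClamp_sa_indicator hIsa ha hb 0
  -- the witnesses
  set U : ℝ → ℝ := fun u => A (max a (min u b)) * A a + B (max a (min u b)) * B a with hU
  set W : ℝ → ℝ := fun u => B (max a (min u b)) * A a - A (max a (min u b)) * B a with hW
  set U' : ℝ → ℝ := fun u => χ u * (A' u * A a + B' u * B a) with hU'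
  set W' : ℝ → ℝ := fun u => χ u * (B' u * A a - A' u * B a) with hW'
  -- semialgebraicity (closure under ring operations, BCR Prop. 2.2.6)
  have hUsa : IsSemialgebraicFunOn ℚ I (fun z => U (z 0)) :=
    (hAcsa.fun_mul hAasa).fun_add (hBcsa.fun_mul hBasa)
  have hWsa : IsSemialgebraicFunOn ℚ I (fun z => W (z 0)) :=
    (hBcsa.fun_mul hAasa).fun_sub (hAcsa.fun_mul hBasa)
  have hU'sa : IsSemialgebraicFunOn ℚ I (fun z => U' (z 0)) :=
    hχsa.fun_mul ((hA'sa.fun_mul hAasa).fun_add (hB'sa.fun_mul hBasa))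
  have hW'sa : IsSemialgebraicFunOn ℚ I (fun z => W' (z 0)) :=
    hχsa.fun_mul ((hB'sa.fun_mul hAasa).fun_sub (hA'sa.fun_mul hBasa))
  -- continuity
  have hUc : Continuous U := (hAcc.mul continuous_const).add (hBcc.mul continuous_const)
  have hWc : Continuous W := (hBcc.mul continuous_const).sub (hAcc.mul continuous_const)
  -- positivity of `U` on the whole interval (the clamp lands in `[a, b]`)
  have hUpos : ∀ u, 0 < U u := fun u => hpos _ (hcmem u)
  -- bounds on the derivatives: `|χ| ≤ 1` times a function continuous on the compact interval
  have hbd : ∀ f : ℝ → ℝ, ContinuousOn f (Set.Icc (0:ℝ) 1) →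
      ∃ M : ℝ, ∀ u ∈ Set.Icc (0:ℝ) 1, |χ u * f u| ≤ M := by
    intro f hf
    obtain ⟨M, hM⟩ := isCompact_Icc.exists_bound_of_continuousOn hf
    refine ⟨M, fun u hu => ?_⟩
    rw [abs_mul]
    exact (mul_le_of_le_one_left (abs_nonneg _) (hχabs u)).trans
      (by simpa only [Real.norm_eq_abs] using hM u hu)
  obtain ⟨M₁, hM₁⟩ := hbd (fun u => A' u * A a + B' u * B a)
    ((hA'c.mul continuousOn_const).add (hB'c.mul continuousOn_const))
  obtain ⟨M₂, hM₂⟩ := hbd (fun u => B' u * A a - A' u * B a)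
    ((hB'c.mul continuousOn_const).sub (hA'c.mul continuousOn_const))
  refine ⟨U, W, U', W', hUsa, hWsa, hU'sa, hW'sa, hUc.continuousOn, hWc.continuousOn,
    fun u _ => hUpos u, ⟨max M₁ M₂, fun u hu => ⟨(hM₁ u hu).trans (le_max_left _ _),
      (hM₂ u hu).trans (le_max_right _ _)⟩⟩, fun u hu hua hub => ?_, fun u _ => rfl, fun u _ => rfl,
    fun u _ hua hub => ?_⟩
  · -- derivatives off the kinks
    rcases lt_or_gt_of_ne hua with hlt | hgt
    · -- left of `a`: the clamped atoms are locally constant, `χ = 0`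
      have hn : ¬(a < u ∧ u < b) := fun h => lt_asymm hlt h.1
      have hU'u : U' u = 0 * A a + 0 * B a := by
        simp only [hU', hχ, if_neg hn, zero_mul, add_zero]
      have hW'u : W' u = 0 * A a - 0 * B a := by
        simp only [hW', hχ, if_neg hn, zero_mul, sub_zero]
      rw [hU'u, hW'u]
      exact ⟨((clampNL_hasDerivAt_of_lt (φ := A) (b₀ := b) hlt).mul_const (A a)).add
          ((clampNL_hasDerivAt_of_lt (φ := B) (b₀ := b) hlt).mul_const (B a)),
        ((clampNL_hasDerivAt_of_lt (φ := B) (b₀ := b) hlt).mul_const (A a)).sub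
          ((clampNL_hasDerivAt_of_lt (φ := A) (b₀ := b) hlt).mul_const (B a))⟩
    · rcases lt_or_gt_of_ne hub with hlt' | hgt'
      · -- inside `(a, b) ⊆ (0, 1)`: the clamp is the identity near `u`
        have hin : a < u ∧ u < b := ⟨hgt, hlt'⟩
        have hU'u : U' u = A' u * A a + B' u * B a := by
          simp only [hU', hχ, if_pos hin, one_mul]
        have hW'u : W' u = B' u * A a - A' u * B a := by
          simp only [hW', hχ, if_pos hin, one_mul]
        rw [hU'u, hW'u]
        exact ⟨((clampNL_hasDerivAt_of_mem hin (hAd u hu)).mul_const (A a)).add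
            ((clampNL_hasDerivAt_of_mem hin (hBd u hu)).mul_const (B a)),
          ((clampNL_hasDerivAt_of_mem hin (hBd u hu)).mul_const (A a)).sub
            ((clampNL_hasDerivAt_of_mem hin (hAd u hu)).mul_const (B a))⟩
      · -- right of `b`: locally constant again
        have hn : ¬(a < u ∧ u < b) := fun h => lt_asymm hgt' h.2
        have hU'u : U' u = 0 * A a + 0 * B a := by
          simp only [hU', hχ, if_neg hn, zero_mul, add_zero]
        have hW'u : W' u = 0 * A a - 0 * B a := by
          simp only [hW', hχ, if_neg hn, zero_mul, sub_zero]
        rw [hU'u, hW'u]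
        exact ⟨((clampNL_hasDerivAt_of_gt (φ := A) hale hgt').mul_const (A a)).add
            ((clampNL_hasDerivAt_of_gt (φ := B) hale hgt').mul_const (B a)),
          ((clampNL_hasDerivAt_of_gt (φ := B) hale hgt').mul_const (A a)).sub
            ((clampNL_hasDerivAt_of_gt (φ := A) hale hgt').mul_const (B a))⟩
  · -- the angular form: rotation invariance inside `(a, b)`, zero outside `[a, b]`
    by_cases hin : a < u ∧ u < b
    · have hcu : max a (min u b) = u := clampNL_of_mem ⟨hin.1.le, hin.2.le⟩
      rw [if_pos hin]
      have hnum : U u * W' u - U' u * W u = (A a ^ 2 + B a ^ 2) * (A u * B' u - A' u * B u) := by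
        simp only [hU, hW, hU', hW', hχ, if_pos hin, one_mul, hcu]
        ring
      have hden : U u ^ 2 + W u ^ 2 = (A a ^ 2 + B a ^ 2) * (A u ^ 2 + B u ^ 2) := by
        simp only [hU, hW, hcu]
        ring
      rw [hnum, hden, mul_div_mul_left _ _ hE0]
    · rw [if_neg hin]
      have hnum : U u * W' u - U' u * W u = 0 := by
        simp only [hU', hW', hχ, if_neg hin, zero_mul, mul_zero, sub_zero]
      rw [hnum, zero_div]

end Summit.KontsevichZagierPeriods.KontsevichZagierPeriods.Cruxes.StokesGeneration.FibrewiseStokes
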